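import Mathlib.LinearAlgebra.Matrix.Block
import Literature.Analysis.SpecialFunctions.SelbergLimit
import Summits.KontsevichZagierPeriods.KontsevichZagierPeriods.Theorems.ValuedFieldSpecialisationCTConstructionDilateTyped
import Summits.KontsevichZagierPeriods.KontsevichZagierPeriods.Theorems.ValuedFieldSpecialisationClassLevelExpansionFibreDimOneToolkit

/-!
# Route ValuedFieldSpecialisation — crux `CTConstruction`: splitting a typed coordinate at `t = s`

Helper toward crux stmt-KontsevichZagierPeriods-3495 (`CTConstruction`), line `registered`, stub
`stub_split_typedElementary` of the lead's "dilation elimination". A **typed elementary family**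
`R : KZ.IntegralRep (B + d + 2)` has coordinates `z = (s, u, t, w)` (`s = z 0` the parameter,
`u = z 1`, the typed block `t : Fin B → ℝ`, `w : Fin d → ℝ`), domain `0 < s < 1`, `0 < u`,
`u ^ Q * s ^ p < 1`, `κ j * s ^ (e j) ≤ t j ≤ 1`, `w ∈ r.domain`, and integrand
`∏ (t j)⁻¹ * r.integrand w`. For a coordinate `t j` of type `[κ j * s, 1]` (`e j = 1`, `κ j ≤ 1`)
we split the domain at `t j = s` (domain additivity, the overlap `{t j = s}` being a null
hyperplane section): the piece `{s ≤ t j}` is VERBATIM the typed family with `κ j` replaced by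
`1` (a restriction of `R`); the piece `{t j ≤ s}` is carried by the FIBRED substitution
`t j = s η` onto the typed family with `e j` replaced by `0` (`η ∈ [κ j, 1]`). The substitution is
treated for an arbitrary interior coordinate `i ≠ 0`: the **shear** `Ψ z = update z i (z i * z 0)`
is a polynomial map fixing `z 0`, injective on `{0 < z 0}`, with lower-triangular derivative of
determinant `z 0`, so a representation `R'` on whose domain `0 < z 0`, with an integrand `f`
satisfying `f z = f (Ψ z) * z 0` (here `(s η)⁻¹ * s = η⁻¹`), is fibred-equivalent to the
representation on `Ψ ⁻¹' R'.domain` with integrand `f`, CONSTRUCTED by transport of structure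
(preimage of a semialgebraic set under a polynomial map, composite of a semialgebraic function
with a polynomial map, `MeasureTheory.integrableOn_image_iff_integrableOn_abs_det_fderiv_smul`).

Sources: M. Kontsevich, D. Zagier, *Periods* (2001), §1.2 (rules (1)–(2)); J. Bochnak, M. Coste,
M.-F. Roy, *Real Algebraic Geometry* (1998), §2.2 (Prop. 2.2.6). No new definitions.
-/

noncomputable section

namespace Summit.KontsevichZagierPeriods.ValuedFieldSpecialisation

open MeasureTheory Set Filter MvPolynomial
open Literature.NumberTheory.Transcendental Literature.NumberTheory.Transcendental.KZ
open Literature.ModelTheory.ExponentialFields (IsSemialgebraic isSemialgebraic_setOf_eval_le)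

/-! ## The shear `z ↦ update z i (z i * z 0)` -/

/-- **Derivative and Jacobian of the shear.** The polynomial map `Ψ z = update z i (z i * z 0)`
(`i ≠ 0`) has derivative `v ↦ v + (z i * v 0 + z 0 * v i - v i) • e_i` at `z`, a lower-triangular
endomorphism (the identity except in row `i`, whose diagonal entry is `z 0` and whose entry in
column `0` is `z i`) of determinant `z 0` (`Matrix.det_of_lowerTriangular`). [folklore] -/
theorem shear_data {N : ℕ} (i : Fin (N + 1)) (hi : i ≠ 0) :
    ∃ Φ' : (Fin (N + 1) → ℝ) → (Fin (N + 1) → ℝ) →L[ℝ] (Fin (N + 1) → ℝ),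
      (∀ x, HasFDerivAt (fun z : Fin (N + 1) → ℝ => Function.update z i (z i * z 0)) (Φ' x) x) ∧
        ∀ x, (Φ' x).det = x 0 := by
  let π : Fin (N + 1) → (Fin (N + 1) → ℝ) →L[ℝ] ℝ := fun k =>
    ContinuousLinearMap.proj (R := ℝ) (φ := fun _ : Fin (N + 1) => ℝ) k
  let Φ' : (Fin (N + 1) → ℝ) → (Fin (N + 1) → ℝ) →L[ℝ] (Fin (N + 1) → ℝ) := fun x =>
    ContinuousLinearMap.id ℝ (Fin (N + 1) → ℝ) +
      ((x i • π 0 + x 0 • π i) - π i).smulRight (Pi.single i 1)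
  -- the matrix entries `Φ' x e_l k`
  have hΦ' : ∀ x (k l : Fin (N + 1)), LinearMap.toMatrix'
      ((Φ' x : (Fin (N + 1) → ℝ) →L[ℝ] (Fin (N + 1) → ℝ)) :
        (Fin (N + 1) → ℝ) →ₗ[ℝ] (Fin (N + 1) → ℝ)) k l = (Pi.single l 1 : Fin (N + 1) → ℝ) k +
      ((x i * (Pi.single l 1 : Fin (N + 1) → ℝ) 0 + x 0 * (Pi.single l 1 : Fin (N + 1) → ℝ) i) -
        (Pi.single l 1 : Fin (N + 1) → ℝ) i) * (Pi.single i 1 : Fin (N + 1) → ℝ) k :=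
    fun x k l => rfl
  refine ⟨Φ', fun x => ?_, fun x => ?_⟩
  · have hfun : (fun z : Fin (N + 1) → ℝ => Function.update z i (z i * z 0)) =
        fun z => z + (z i * z 0 - z i) • (Pi.single i 1 : Fin (N + 1) → ℝ) := by
      funext z
      ext k
      rcases eq_or_ne k i with rfl | hk
      · simp
      · simp [hk]
    rw [hfun]
    exact (hasFDerivAt_id x).add ((((hasFDerivAt_apply i x).mul (hasFDerivAt_apply 0 x)).sub
      (hasFDerivAt_apply i x)).smul_const _)
  · -- lower triangular, diagonal `(1, …, x 0, …, 1)` (pattern of `cpm_det_of_lowerTriangular`,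
    -- Theorems/SymplecticScissorsVolumeFormOffPlaneCumprodMove.lean)
    rw [ContinuousLinearMap.det, ← LinearMap.det_toMatrix', Matrix.det_of_lowerTriangular _ ?_]
    · have hdiag : ∀ k, LinearMap.toMatrix' ((Φ' x : (Fin (N + 1) → ℝ) →L[ℝ] (Fin (N + 1) → ℝ)) :
          (Fin (N + 1) → ℝ) →ₗ[ℝ] (Fin (N + 1) → ℝ)) k k = if k = i then x 0 else 1 := by
        intro k
        rw [hΦ', Pi.single_eq_same]
        rcases eq_or_ne k i with rfl | hk
        · rw [if_pos rfl, Pi.single_eq_same, Pi.single_eq_of_ne (Ne.symm hi)]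
          ring
        · rw [if_neg hk, Pi.single_eq_of_ne hk, mul_zero, add_zero]
      simp [hdiag]
    · intro k l hkl
      have hkl' : k < l := hkl
      rw [hΦ', Pi.single_eq_of_ne (ne_of_lt hkl')]
      rcases eq_or_ne k i with rfl | hk
      · have hl0 : (0 : Fin (N + 1)) ≠ l := fun h => by
          rw [← h] at hkl'
          simp at hkl'
        simp only [Pi.single_eq_of_ne (ne_of_lt hkl'), Pi.single_eq_of_ne hl0, mul_zero,
          add_zero, sub_zero, zero_mul]
      · rw [Pi.single_eq_of_ne hk, mul_zero, add_zero]

/-- The shear is the polynomial map with coordinates `update X i (X i * X 0)`. [folklore] -/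
theorem aeval_shearPoly {N : ℕ} (i : Fin (N + 1)) (z : Fin (N + 1) → ℝ) (k : Fin (N + 1)) :
    aeval z (Function.update (fun k : Fin (N + 1) => (X k : MvPolynomial (Fin (N + 1)) ℚ)) i
      (X i * X 0) k) = Function.update z i (z i * z 0) k := by
  rcases eq_or_ne k i with rfl | hk
  · simp
  · simp [hk]

/-- The shear is a `ℚ`-semialgebraic map on every `ℚ`-semialgebraic set
(`isSemialgebraicMapOn_aeval`). [Bochnak–Coste–Roy 1998, §2.2] [folklore] -/
theorem isSemialgebraicMapOn_shear {N : ℕ} {σ : Set (Fin (N + 1) → ℝ)} (hσ : IsSemialgebraic ℚ σ)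
    (i : Fin (N + 1)) :
    IsSemialgebraicMapOn ℚ σ (fun z : Fin (N + 1) → ℝ => Function.update z i (z i * z 0)) :=
  (isSemialgebraicMapOn_aeval hσ _).congr fun z _ => funext (aeval_shearPoly i z)

/-- The preimage of a `ℚ`-semialgebraic set under the shear is `ℚ`-semialgebraic
(`IsSemialgebraic.preimage_aeval`). [Bochnak–Coste–Roy 1998, §2.1] [folklore] -/
theorem isSemialgebraic_setOf_shear_mem {N : ℕ} {σ : Set (Fin (N + 1) → ℝ)}
    (hσ : IsSemialgebraic ℚ σ) (i : Fin (N + 1)) :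
    IsSemialgebraic ℚ {z : Fin (N + 1) → ℝ | Function.update z i (z i * z 0) ∈ σ} := by
  have h := hσ.preimage_aeval
    (Function.update (fun k : Fin (N + 1) => (X k : MvPolynomial (Fin (N + 1)) ℚ)) i (X i * X 0))
  have hD : (fun (x : Fin (N + 1) → ℝ) (j : Fin (N + 1)) => aeval x
      (Function.update (fun k : Fin (N + 1) => (X k : MvPolynomial (Fin (N + 1)) ℚ)) i
        (X i * X 0) j)) = fun z => Function.update z i (z i * z 0) :=
    funext fun z => funext (aeval_shearPoly i z)
  rwa [hD] at h

/-- **Transport through the shear.** Let `R'` be a representation in dimension `N + 1` on whose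
domain `0 < z 0`, with integrand (everywhere) `f`, and let `i ≠ 0`. Suppose that on the preimage
`D = Ψ ⁻¹' R'.domain` of the domain under the shear `Ψ z = update z i (z i * z 0)` one has
`f z = f (Ψ z) * z 0`. Then `D` carries a representation `R''` with integrand `f`, and
`[R'] - [R''] ∈ fibredRelations`: `Ψ` is a fibred change of variables from `R''` onto `R'`
(polynomial, injective on `{0 < z 0}`, `Ψ z 0 = z 0`, Jacobian `z 0 > 0`), and `R''` is
integrable by the change-of-variables formula. [Kontsevich–Zagier 2001, §1.2 rule (2)]
[folklore] -/
theorem exists_rep_of_sub_mem_fibredRelations_shear {N : ℕ} (i : Fin (N + 1)) (hi : i ≠ 0)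
    (R' : IntegralRep (N + 1)) {f : (Fin (N + 1) → ℝ) → ℝ} (hR'i : ∀ z, R'.integrand z = f z)
    (hpos : ∀ z ∈ R'.domain, 0 < z 0)
    (hf : ∀ z : Fin (N + 1) → ℝ, Function.update z i (z i * z 0) ∈ R'.domain →
      f z = f (Function.update z i (z i * z 0)) * z 0) :
    ∃ R'' : IntegralRep (N + 1), R''.domain = {z | Function.update z i (z i * z 0) ∈ R'.domain} ∧
      R''.integrand = f ∧ of R' - of R'' ∈ fibredRelations := by
  obtain ⟨Φ', hderiv, hdet⟩ := shear_data i hi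
  set D : Set (Fin (N + 1) → ℝ) := {z | Function.update z i (z i * z 0) ∈ R'.domain}
  have hsa : IsSemialgebraic ℚ D := isSemialgebraic_setOf_shear_mem R'.isSemialgebraic_domain i
  have hmeas : MeasurableSet D := IsSemialgebraic.measurableSet_holds hsa
  have h0 : ∀ z : Fin (N + 1) → ℝ, Function.update z i (z i * z 0) 0 = z 0 := fun z =>
    Function.update_of_ne hi.symm _ _
  have hposD : ∀ z ∈ D, 0 < z 0 := fun z hz => h0 z ▸ hpos (Function.update z i (z i * z 0)) hz
  -- `Ψ` is injective on `D` and maps `D` onto `R'.domain`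
  have hinj : InjOn (fun z : Fin (N + 1) → ℝ => Function.update z i (z i * z 0)) D := by
    intro z₁ _ z₂ hz₂ h
    have h0' : z₁ 0 = z₂ 0 := by simpa only [h0] using congrFun h 0
    refine funext fun k => ?_
    rcases eq_or_ne k i with rfl | hk
    · refine mul_right_cancel₀ (hposD _ hz₂).ne' ?_
      simpa only [Function.update_self, h0'] using congrFun h k
    · simpa only [Function.update_of_ne hk] using congrFun h k
  have himg : (fun z : Fin (N + 1) → ℝ => Function.update z i (z i * z 0)) '' D = R'.domain := by
    refine subset_antisymm (image_subset_iff.mpr fun z hz => hz) fun y hy => ?_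
    have hback : Function.update (Function.update y i (y i / y 0)) i
        (Function.update y i (y i / y 0) i * Function.update y i (y i / y 0) 0) = y := by
      rw [Function.update_self, Function.update_of_ne hi.symm, Function.update_idem,
        div_mul_cancel₀ _ (hpos y hy).ne', Function.update_eq_self]
    refine ⟨Function.update y i (y i / y 0), ?_, hback⟩
    show Function.update (Function.update y i (y i / y 0)) i _ ∈ R'.domain
    rw [hback]
    exact hy
  -- the transported integrand is semialgebraic and integrable on `D`
  have hfi : IsSemialgebraicFunOn ℚ D f := by
    refine (IsSemialgebraicFunOn.mul_holds (IsSemialgebraicFunOn.comp_isSemialgebraicMapOn_holds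
      R'.isSemialgebraicFunOn_integrand (isSemialgebraicMapOn_shear hsa i) fun z hz => hz)
      (isSemialgebraicFunOn_apply hsa (0 : Fin (N + 1)))).congr fun z hz => ?_
    rw [Pi.mul_apply, Function.comp_apply, hR'i]
    exact (hf z hz).symm
  have hint : IntegrableOn f D volume := by
    refine ((integrableOn_image_iff_integrableOn_abs_det_fderiv_smul volume hmeas
      (fun x _ => (hderiv x).hasFDerivWithinAt) hinj R'.integrand).mp
        (by rw [himg]; exact R'.integrableOn)).congr_fun (fun z hz => ?_) hmeas
    dsimp only
    rw [smul_eq_mul, hdet, abs_of_pos (hposD z hz), hR'i, mul_comm]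
    exact (hf z hz).symm
  refine ⟨⟨D, f, hsa, hfi, hint⟩, rfl, rfl, ?_⟩
  -- `Ψ` is a fibred change of variables from `R''` onto `R'`
  have hcov : of (⟨D, f, hsa, hfi, hint⟩ : IntegralRep (N + 1)) - of R' ∈
      fibredChangeOfVariablesRel :=
    of_sub_of_mem_fibredChangeOfVariablesRel
      (Φ := fun z : Fin (N + 1) → ℝ => Function.update z i (z i * z 0)) (Φ' := Φ')
      (isSemialgebraicMapOn_shear hsa i) (fun x _ => (hderiv x).hasFDerivWithinAt) hinj himg.symm
      (fun x hx => by
        dsimp only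
        rw [hdet, abs_of_pos (hposD x hx), hR'i]
        exact hf x hx)
      (fun x _ => h0 x)
  simpa only [neg_sub] using
    fibredRelations.neg_mem (mem_fibredRelations_of_mem_fibredChangeOfVariablesRel hcov)

/-! ## Typed bands and the typed integrand under the shear -/

/-- Piece `{s ≤ t j}` of the splitting: for `κ j ≤ 1`, `e j = 1` and `s > 0`, the typed band
conditions with `κ j` replaced by `1` are the typed band conditions together with `s ≤ t j`
(`κ j * s ≤ s`). [folklore] -/
theorem typedBand_update_one_iff {B : ℕ} {κ : Fin B → ℚ} {e : Fin B → ℕ} {j : Fin B}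
    (hκ : κ j ≤ 1) (hej : e j = 1) {s : ℝ} (hs : 0 < s) (t : Fin B → ℝ) :
    (∀ j', ((Function.update κ j 1 j' : ℚ) : ℝ) * s ^ (e j') ≤ t j' ∧ t j' ≤ 1) ↔
      (∀ j', ((κ j' : ℚ) : ℝ) * s ^ (e j') ≤ t j' ∧ t j' ≤ 1) ∧ s ≤ t j := by
  have hκ' : ((κ j : ℚ) : ℝ) ≤ 1 := by exact_mod_cast hκ
  constructor
  · intro h
    have hj := h j
    rw [Function.update_self, Rat.cast_one, one_mul, hej, pow_one] at hj
    refine ⟨fun j' => ?_, hj.1⟩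
    by_cases hne : j' = j
    · rw [hne, hej, pow_one]
      exact ⟨(mul_le_of_le_one_left hs.le hκ').trans hj.1, hj.2⟩
    · have := h j'
      rwa [Function.update_of_ne hne] at this
  · rintro ⟨h, hsj⟩ j'
    by_cases hne : j' = j
    · rw [hne, Function.update_self, Rat.cast_one, one_mul, hej, pow_one]
      exact ⟨hsj, (h j).2⟩
    · rw [Function.update_of_ne hne]
      exact h j'

/-- Piece `{t j ≤ s}` of the splitting read through the shear `t j = s η`: for `e j = 1`,
`0 < s < 1` and `t'` obtained from `t` by replacing `t j` with `t j * s`, the typed band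
conditions for `t` with `e j` replaced by `0` (`κ j ≤ t j ≤ 1`) are the typed band conditions
for `t'` together with `t j * s ≤ s`. [folklore] -/
theorem typedBand_update_zero_iff {B : ℕ} (κ : Fin B → ℚ) {e : Fin B → ℕ} {j : Fin B}
    (hej : e j = 1) {s : ℝ} (hs : 0 < s) (hs1 : s < 1) {t t' : Fin B → ℝ}
    (htj : t' j = t j * s) (ht' : ∀ j', j' ≠ j → t' j' = t j') :
    (∀ j', ((κ j' : ℚ) : ℝ) * s ^ (Function.update e j 0 j') ≤ t j' ∧ t j' ≤ 1) ↔
      (∀ j', ((κ j' : ℚ) : ℝ) * s ^ (e j') ≤ t' j' ∧ t' j' ≤ 1) ∧ t j * s ≤ s := by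
  constructor
  · intro h
    have hj := h j
    rw [Function.update_self, pow_zero, mul_one] at hj
    have hts : t j * s ≤ s := mul_le_of_le_one_left hs.le hj.2
    refine ⟨fun j' => ?_, hts⟩
    by_cases hne : j' = j
    · rw [hne, htj, hej, pow_one]
      exact ⟨mul_le_mul_of_nonneg_right hj.1 hs.le, hts.trans hs1.le⟩
    · rw [ht' j' hne]
      have := h j'
      rwa [Function.update_of_ne hne] at this
  · rintro ⟨h, hle⟩ j'
    by_cases hne : j' = j
    · rw [hne, Function.update_self, pow_zero, mul_one]
      have hj := h j
      rw [htj, hej, pow_one] at hj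
      exact ⟨le_of_mul_le_mul_right hj.1 hs, le_of_mul_le_mul_right (by rwa [one_mul]) hs⟩
    · rw [Function.update_of_ne hne, ← ht' j' hne]
      exact h j'

/-- The typed integrand transforms under the shear of the coordinate of `t j` by the Jacobian
`z 0`: `f z = f (Ψ z) * z 0` for `z 0 ≠ 0` (`(t_j s)⁻¹ * s = t_j⁻¹`; the other coordinates read by
`f` are unchanged). [folklore] -/
theorem typedIntegrand_shear {B d : ℕ} (ρ : IntegralRep d) (j : Fin B)
    (z : Fin (B + d + 1 + 1) → ℝ) (h0 : z 0 ≠ 0) :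
    (∏ j' : Fin B, (z (Fin.castAdd d j').succ.succ)⁻¹) *
        ρ.integrand (fun l : Fin d => z (Fin.natAdd B l).succ.succ) =
      (∏ j' : Fin B, (Function.update z (Fin.castAdd d j).succ.succ
          (z (Fin.castAdd d j).succ.succ * z 0) (Fin.castAdd d j').succ.succ)⁻¹) *
        ρ.integrand (fun l : Fin d => Function.update z (Fin.castAdd d j).succ.succ
          (z (Fin.castAdd d j).succ.succ * z 0) (Fin.natAdd B l).succ.succ) * z 0 := by
  have hw : ∀ l : Fin d, (Fin.natAdd B l).succ.succ ≠ (Fin.castAdd d j).succ.succ := fun l h => by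
    have h' := congrArg Fin.val h
    simp only [Fin.val_succ, Fin.val_natAdd, Fin.val_castAdd] at h'
    have := j.isLt
    omega
  have ht : ∀ j' : Fin B, j' ≠ j → (Fin.castAdd d j').succ.succ ≠ (Fin.castAdd d j).succ.succ :=
    fun j' hne h => hne (Fin.castAdd_injective _ _ (Fin.succ_inj.mp (Fin.succ_inj.mp h)))
  simp only [Function.update_of_ne (hw _)]
  have hprod : (∏ j' : Fin B, (Function.update z (Fin.castAdd d j).succ.succ
      (z (Fin.castAdd d j).succ.succ * z 0) (Fin.castAdd d j').succ.succ)⁻¹) =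
      (∏ j' : Fin B, (z (Fin.castAdd d j').succ.succ)⁻¹) * (z 0)⁻¹ := by
    have hfac : ∀ j' : Fin B, (Function.update z (Fin.castAdd d j).succ.succ
        (z (Fin.castAdd d j).succ.succ * z 0) (Fin.castAdd d j').succ.succ)⁻¹ =
        (z (Fin.castAdd d j').succ.succ)⁻¹ * (if j' = j then (z 0)⁻¹ else 1) := by
      intro j'
      by_cases hne : j' = j
      · rw [if_pos hne, hne, Function.update_self, mul_inv]
      · rw [if_neg hne, Function.update_of_ne (ht j' hne), mul_one]
    rw [Finset.prod_congr rfl fun j' _ => hfac j', Finset.prod_mul_distrib, Finset.prod_ite_eq']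
    simp
  rw [hprod, mul_right_comm _ (z 0)⁻¹, inv_mul_cancel_right₀ h0]

/-! ## The stub -/

/-- **Stub `stub_split_typedElementary`.** For a typed elementary family `R` (lower-bound
coefficients `κ`, exponents `e`) and a coordinate `t j` of type `[κ j * s, 1]` (`e j = 1`,
`κ j ≤ 1`), splitting at `t j = s` gives, modulo FIBRED relations, `[R] ≡ [R₁] + [R₂]`:
`R.domain = A ∪ B'` with `A = R.domain ∩ {s ≤ t j}` — the typed domain with `κ j` replaced by
`1`, `R₁ = R|A` — and `B' = R.domain ∩ {t j ≤ s}`, overlapping in a null hyperplane section, so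
`[R] - [R|A] - [R|B'] ∈ fibredRelations` (domain additivity); and `R|B'` is carried by the shear
`t j = s η` (a fibred change of variables, `exists_rep_of_sub_mem_fibredRelations_shear`,
`(s η)⁻¹ s = η⁻¹`) onto the typed family `R₂` with `e j` replaced by `0`, whose domain is the
preimage of `B'`. [Kontsevich–Zagier 2001, §1.2 rules (1)–(2)] [folklore] -/
theorem stub_split_typedElementary : ∀ (Q p B d : ℕ) (κ : Fin B → ℚ) (e : Fin B → ℕ) (r : Literature.NumberTheory.Transcendental.KZ.IntegralRep d) (j : Fin B) (R : Literature.NumberTheory.Transcendental.KZ.IntegralRep (B + d + 1 + 1)), κ j ≤ 1 → e j = 1 → R.domain = {z | ∃ (s u : ℝ) (t : Fin B → ℝ) (w : Fin d → ℝ), z = Matrix.vecCons s (Matrix.vecCons u (Fin.append t w)) ∧ 0 < s ∧ s < 1 ∧ 0 < u ∧ u ^ Q * s ^ p < 1 ∧ (∀ j, ((κ j : ℚ) : ℝ) * s ^ (e j) ≤ t j ∧ t j ≤ 1) ∧ w ∈ r.domain} → R.integrand = (fun z => (∏ j : Fin B, (z (Fin.castAdd d j).succ.succ)⁻¹) * r.integrand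 (fun l : Fin d => z (Fin.natAdd B l).succ.succ)) → ∃ R₁ R₂ : Literature.NumberTheory.Transcendental.KZ.IntegralRep (B + d + 1 + 1), R₁.domain = {z | ∃ (s u : ℝ) (t : Fin B → ℝ) (w : Fin d → ℝ), z = Matrix.vecCons s (Matrix.vecCons u (Fin.append t w)) ∧ 0 < s ∧ s < 1 ∧ 0 < u ∧ u ^ Q * s ^ p < 1 ∧ (∀ j', ((Function.update κ j 1 j' : ℚ) : ℝ) * s ^ (e j') ≤ t j' ∧ t j' ≤ 1) ∧ w ∈ r.domain} ∧ R₁.integrand = (fun z => (∏ j : Fin B, (z (Fin.castAdd d j).succ.succ)⁻¹) * r.integrand (fun l : Fin d => z (Fin.natAdd B l).succ.succ)) ∧ R₂.domain = {z | ∃ (s u : ℝ) (t : Fin B → ℝ) (w : Fin d → ℝ), z = Matrix.vecCons s (Matrix.vecCons u (Fin.append t w)) ∧ 0 < s ∧ s < 1 ∧ 0 < u ∧ u ^ Q * s ^ p < 1 ∧ (∀ j', ((κ j' : ℚ) : ℝ) * s ^ (Function.update e j 0 j') ≤ t j' ∧ t j' ≤ 1) ∧ w ∈ r.domain} ∧ R₂.integrand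 = (fun z => (∏ j : Fin B, (z (Fin.castAdd d j).succ.succ)⁻¹) * r.integrand (fun l : Fin d => z (Fin.natAdd B l).succ.succ)) ∧ Literature.NumberTheory.Transcendental.KZ.of R - Literature.NumberTheory.Transcendental.KZ.of R₁ - Literature.NumberTheory.Transcendental.KZ.of R₂ ∈ Literature.NumberTheory.Transcendental.KZ.fibredRelations := by
  intro Q p B d κ e r j R hκ hej hR hRi
  rw [typedDomain_eq Q p B (fun j' => ((Function.update κ j 1 j' : ℚ) : ℝ)) e r,
    typedDomain_eq Q p B (fun j' => ((κ j' : ℚ) : ℝ)) (Function.update e j 0) r]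
  replace hR := hR.trans (typedDomain_eq Q p B (fun j' => ((κ j' : ℚ) : ℝ)) e r)
  -- the index `i` of `t j`; it differs from `0`, `1`, the other `t j'` and the `w l`
  set i : Fin (B + d + 1 + 1) := (Fin.castAdd d j).succ.succ with hi
  have hi0 : i ≠ 0 := succ_succ_ne_zero (Fin.castAdd d j)
  have hi1 : i ≠ 1 := succ_succ_ne_one (Fin.castAdd d j)
  have hit : ∀ j' : Fin B, j' ≠ j → (Fin.castAdd d j').succ.succ ≠ i := fun j' hne h =>
    hne (Fin.castAdd_injective _ _ (Fin.succ_inj.mp (Fin.succ_inj.mp h)))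
  have hiw : ∀ l : Fin d, (Fin.natAdd B l).succ.succ ≠ i := fun l h => by
    have h' := congrArg Fin.val h
    simp only [hi, Fin.val_succ, Fin.val_natAdd, Fin.val_castAdd] at h'
    have := j.isLt
    omega
  -- the pieces `A = R.domain ∩ {s ≤ t j}`, `B' = R.domain ∩ {t j ≤ s}`; the overlap is null
  have hle_sa : IsSemialgebraic ℚ {z : Fin (B + d + 1 + 1) → ℝ | z 0 ≤ z i} := by
    simpa using isSemialgebraic_setOf_eval_le (k := ℚ) (R := ℝ)
      (X (0 : Fin (B + d + 1 + 1)) : MvPolynomial (Fin (B + d + 1 + 1)) ℚ) (X i)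
  have hge_sa : IsSemialgebraic ℚ {z : Fin (B + d + 1 + 1) → ℝ | z i ≤ z 0} := by
    simpa using isSemialgebraic_setOf_eval_le (k := ℚ) (R := ℝ)
      (X i : MvPolynomial (Fin (B + d + 1 + 1)) ℚ) (X 0)
  set A : Set (Fin (B + d + 1 + 1) → ℝ) := R.domain ∩ {z | z 0 ≤ z i} with hA
  set B' : Set (Fin (B + d + 1 + 1) → ℝ) := R.domain ∩ {z | z i ≤ z 0} with hB'
  have hAsa : IsSemialgebraic ℚ A := R.isSemialgebraic_domain.inter hle_sa
  have hB'sa : IsSemialgebraic ℚ B' := R.isSemialgebraic_domain.inter hge_sa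
  have hunion : R.domain = A ∪ B' := by
    rw [hA, hB', ← inter_union_distrib_left]
    exact (inter_eq_left.mpr fun z _ => le_total (z 0) (z i)).symm
  have hnull : volume (A ∩ B') = 0 :=
    measure_mono_null (fun z hz => le_antisymm hz.2.2 hz.1.2)
      (Literature.Analysis.SpecialFunctions.Selberg.volume_setOf_apply_eq hi0)
  have hsplit := of_sub_of_restrict_sub_of_restrict_mem_fibredRelations R hAsa hB'sa hunion hnull
  have hAsub : A ⊆ R.domain := hunion ▸ subset_union_left
  have hB'sub : B' ⊆ R.domain := hunion ▸ subset_union_right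
  -- transport `R|B'` through the shear `Ψ z = update z i (z i * z 0)`
  have hΨ0 : ∀ z : Fin (B + d + 1 + 1) → ℝ, Function.update z i (z i * z 0) 0 = z 0 := fun z =>
    Function.update_of_ne hi0.symm _ _
  have hB'pos : ∀ z ∈ (R.restrict B' hB'sa hB'sub).domain, 0 < z 0 := fun z hz => by
    have hz' : z ∈ R.domain := hz.1
    rw [hR] at hz'
    exact hz'.1
  obtain ⟨R₂, hR₂d, hR₂i, hrel⟩ := exists_rep_of_sub_mem_fibredRelations_shear i hi0
    (R.restrict B' hB'sa hB'sub)
    (f := fun z => (∏ j : Fin B, (z (Fin.castAdd d j).succ.succ)⁻¹) *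
      r.integrand (fun l : Fin d => z (Fin.natAdd B l).succ.succ))
    (fun z => by rw [IntegralRep.integrand_restrict, hRi]) hB'pos
    (fun z hz => typedIntegrand_shear r j z (hΨ0 z ▸ hB'pos _ hz).ne')
  refine ⟨R.restrict A hAsa hAsub, R₂, ?_, hRi, ?_, hR₂i, ?_⟩
  · -- `A` is the typed domain with `κ j` replaced by `1`
    ext z
    simp only [IntegralRep.domain_restrict, hA, hR, mem_inter_iff, mem_setOf_eq]
    constructor
    · rintro ⟨⟨h0, h1, hu, huq, ht, hw⟩, hle⟩
      exact ⟨h0, h1, hu, huq,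
        (typedBand_update_one_iff hκ hej h0 (fun j' => z (Fin.castAdd d j').succ.succ)).mpr
          ⟨ht, hle⟩, hw⟩
    · rintro ⟨h0, h1, hu, huq, ht, hw⟩
      obtain ⟨ht', hle⟩ :=
        (typedBand_update_one_iff hκ hej h0 (fun j' => z (Fin.castAdd d j').succ.succ)).mp ht
      exact ⟨⟨h0, h1, hu, huq, ht', hw⟩, hle⟩
  · -- `R₂.domain = Ψ ⁻¹' B'` is the typed domain with `e j` replaced by `0`
    rw [hR₂d]
    ext z
    have htj : Function.update z i (z i * z 0) (Fin.castAdd d j).succ.succ =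
        z (Fin.castAdd d j).succ.succ * z 0 := by
      rw [hi, Function.update_self]
    have ht' : ∀ j' : Fin B, j' ≠ j → Function.update z i (z i * z 0) (Fin.castAdd d j').succ.succ =
        z (Fin.castAdd d j').succ.succ := fun j' hne => Function.update_of_ne (hit j' hne) _ _
    have hΨw : (fun l : Fin d => Function.update z i (z i * z 0) (Fin.natAdd B l).succ.succ) =
        fun l => z (Fin.natAdd B l).succ.succ := funext fun l => Function.update_of_ne (hiw l) _ _
    simp only [IntegralRep.domain_restrict, hB', hR, mem_inter_iff, mem_setOf_eq, hΨ0, hΨw,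
      Function.update_self, Function.update_of_ne (Ne.symm hi1)]
    constructor
    · rintro ⟨⟨h0, h1, hu, huq, ht'', hw⟩, hle⟩
      exact ⟨h0, h1, hu, huq, (typedBand_update_zero_iff κ hej h0 h1
        (t := fun j' => z (Fin.castAdd d j').succ.succ)
        (t' := fun j' => Function.update z i (z i * z 0) (Fin.castAdd d j').succ.succ)
        htj ht').mpr ⟨ht'', hle⟩, hw⟩
    · rintro ⟨h0, h1, hu, huq, ht, hw⟩
      obtain ⟨ht'', hle⟩ := (typedBand_update_zero_iff κ hej h0 h1
        (t := fun j' => z (Fin.castAdd d j').succ.succ)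
        (t' := fun j' => Function.update z i (z i * z 0) (Fin.castAdd d j').succ.succ)
        htj ht').mp ht
      exact ⟨⟨h0, h1, hu, huq, ht'', hw⟩, hle⟩
  · have hsum : of R - of (R.restrict A hAsa hAsub) - of R₂ =
        (of R - of (R.restrict A hAsa hAsub) - of (R.restrict B' hB'sa hB'sub)) +
          (of (R.restrict B' hB'sa hB'sub) - of R₂) := by
      abel
    rw [hsum]
    exact fibredRelations.add_mem hsplit hrel

end Summit.KontsevichZagierPeriods.ValuedFieldSpecialisation
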